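import Summits.MatrixMultiplication.MatrixMultiplication.Theorems.AbelianSTPPCensusFP4Defs

/-!
# Rule U11-F4, checker soundness I: one target class (`violT`, `viol0`, `scanW`)

Cell mm-stpp (rung F-M1), theory lane «past the quartet's walls» (seat mm-stpp-theory, gen 17).  First of three files proving the Boolean
checker `FP4.check` of `AbelianSTPPCensusFP4Defs.lean` sound (`…FP4CheckForm.lean`, `…FP4Check.lean` follow; the end result is
`FP4.not_fp4Adm_of_checkBoth`).  All in truncated natural-number arithmetic; no convexity is needed because the checker scans downward.
* `seqN/seqB/seqQ/seqPr/seqBox` are application (`seqN_eq`, …) — they only steer the kernel's evaluation order.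
* ONE TARGET (`violT_false`, `viol0_false`): let the four pair boxes contain the true class pairs `(u_g, v_g)` and let (F1) hold at the true
  target count `W ≤ p`.  Levels: `t` on a CERTIFIED pair (`good`: `t ≤ ul`, `t ≤ vl`, `uh + vh ≤ p + t`, so Pollard's floor is `t(u+v) − t²`
  exactly, `pairFloor_good`); on any other pair the level `tauB` of its lower corner, at which the floor of the TRUE pair exceeds its ceiling
  share `τ(p − W)` by at least `pc p W ul vl` (`pairFloor_bad`: `min(p, u + v − τ)` is monotone in `u, v`).  Summing the four pairs
  (`pair_bound`), (F1) with `W·min(T, cap) ≤ cap·W` and `S ≤ Σ_g (u_g + v_g)` give exactly the negation of `violT`; `viol0` is the case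
  without certified pairs.  Hence `viol … W = false` at the true `W` (`viol_false`) and the downward scan from any `h ≥ W` stops at or above
  `W` (`le_scanW`).
WHAT THIS IS NOT: no census number, no `ω` statement.  Exact Python twin of the checker: seat folder `calc/fp4lean_twin.py`.
-/

set_option linter.dupNamespace false -- `MatrixMultiplication.MatrixMultiplication` (summit = problem, D-0017)
set_option autoImplicit false

namespace Summit.MatrixMultiplication.MatrixMultiplication.Theorems

open Finset

namespace FP4

/-! ### Checker soundness, part 1: evaluation-order devices and the per-target tests -/

section CheckCore

universe w

/-- `seqN` is application. [bookkeeping] -/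
theorem seqN_eq {β : Sort w} (n : ℕ) (k : ℕ → β) : seqN n k = k n := by
  cases n <;> rfl

/-- `seqB` is application. [bookkeeping] -/
theorem seqB_eq {β : Sort w} (b : Bool) (k : Bool → β) : seqB b k = k b := by
  cases b <;> rfl

/-- `seqQ` is application. [bookkeeping] -/
theorem seqQ_eq {β : Sort w} (q : Q4) (k : Q4 → β) : seqQ q k = k q := by
  cases q; simp only [seqQ, seqN_eq]

/-- `seqPr` is application. [bookkeeping] -/
theorem seqPr_eq {β : Sort w} (q : Pr) (k : Pr → β) : seqPr q k = k q := by
  cases q; simp only [seqPr, seqN_eq]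

/-- `seqBox` is application. [bookkeeping] -/
theorem seqBox_eq {β : Sort w} (b : Box) (k : Box → β) : seqBox b k = k b := by
  cases b; simp only [seqBox, seqQ_eq]

/-! #### The two per-pair facts behind `violT` -/

/-- A CERTIFIED pair at the common level `t`: `t ≤ u`, `t ≤ v`, `u + v ≤ p + t` ⇒ Pollard's floor is `t(u + v) − t²` exactly. [bookkeeping] -/
theorem pairFloor_good {p t u v : ℕ} (htu : t ≤ u) (huv : u + v ≤ p + t) :
    FP2.pairFloor p u v t + t * t = t * (u + v) := by
  unfold FP2.pairFloor
  rw [min_eq_right (by omega), ← Nat.mul_add]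
  congr 1; omega

/-- The level used for a NON-certified pair in the soundness argument: `tOpt` if it earns a positive `pc`, else `0`. [bookkeeping] -/
def tauB (p W ul vl : ℕ) : ℕ := if pc p W ul vl = 0 then 0 else tOpt p W ul vl

/-- `tauB ≤ ul`. [bookkeeping] -/
theorem tauB_le_left (p W ul vl : ℕ) : tauB p W ul vl ≤ ul := by
  unfold tauB tOpt; split_ifs <;> omega

/-- `tauB ≤ vl`. [bookkeeping] -/
theorem tauB_le_right (p W ul vl : ℕ) : tauB p W ul vl ≤ vl := by
  unfold tauB tOpt; split_ifs <;> omega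

/-- A NON-certified pair: at the level `tauB` (admissible for the lower corner, hence for the true sizes `u ≥ ul`, `v ≥ vl`) Pollard's floor of
the TRUE pair exceeds its ceiling share `τ(p − W)` by at least the certified contribution `pc p W ul vl` of the lower corner. [original] -/
theorem pairFloor_bad {p W ul vl u v : ℕ} (hu : ul ≤ u) (hv : vl ≤ v) (hW : W ≤ p) :
    tauB p W ul vl * (p - W) + pc p W ul vl ≤ FP2.pairFloor p u v (tauB p W ul vl) := by
  unfold tauB
  by_cases h0 : pc p W ul vl = 0
  · simp [h0, FP2.pairFloor]
  rw [if_neg h0]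
  -- `pc = τ·(W ∸ d)` with `τ = tOpt`, `d = (p + τ) ∸ (ul + vl)`; positivity gives `d < W`.
  set τ := tOpt p W ul vl with hτ
  have hτl : τ ≤ ul := by rw [hτ]; unfold tOpt; omega
  have hτr : τ ≤ vl := by rw [hτ]; unfold tOpt; omega
  have hpc : pc p W ul vl = τ * (W - ((p + τ) - (ul + vl))) := rfl
  rw [hpc] at h0 ⊢
  have hdW : (p + τ) - (ul + vl) < W := by
    by_contra hc
    exact h0 (by rw [Nat.sub_eq_zero_of_le (by omega), Nat.mul_zero])
  unfold FP2.pairFloor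
  rw [← Nat.mul_add]
  refine Nat.mul_le_mul_left _ ?_
  rcases Nat.le_total p (u + v - τ) with h1 | h1
  · rw [min_eq_left h1]; omega
  · rw [min_eq_right h1]; omega

/-! #### Soundness of `violT`, `viol0`, `viol`, `scanW` for one target -/

/-- A pair box `q` CONTAINS the true pair `(u, v)` (semantics of the checker). [original] -/
def PrIn (q : Pr) (u v : ℕ) : Prop := q.ul ≤ u ∧ u ≤ q.uh ∧ q.vl ≤ v ∧ v ≤ q.vh

/-- The hypothesis (F1) for four explicit pairs `(u_g, v_g)` and target count `W` (semantics of the checker). [original] -/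
def F1 (p cap W u0 v0 u1 v1 u2 v2 u3 v3 : ℕ) : Prop :=
  ∀ τ0 τ1 τ2 τ3 : ℕ, τ0 ≤ u0 → τ0 ≤ v0 → τ1 ≤ u1 → τ1 ≤ v1 → τ2 ≤ u2 → τ2 ≤ v2 → τ3 ≤ u3 → τ3 ≤ v3 →
    FP2.pairFloor p u0 v0 τ0 + FP2.pairFloor p u1 v1 τ1 + FP2.pairFloor p u2 v2 τ2 + FP2.pairFloor p u3 v3 τ3 ≤
      W * min (τ0 + τ1 + τ2 + τ3) cap + (τ0 + τ1 + τ2 + τ3) * (p - W)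

/-- The level of a pair in the soundness argument of `violT`: `t` if certified, `tauB` otherwise. [bookkeeping] -/
def lvl (p t W : ℕ) (q : Pr) : ℕ := if good p t q then t else tauB p W q.ul q.vl

/-- The level is admissible for the true pair. [bookkeeping] -/
theorem lvl_le {p t W : ℕ} {q : Pr} {u v : ℕ} (hin : PrIn q u v) : lvl p t W q ≤ u ∧ lvl p t W q ≤ v := by
  obtain ⟨h1, h2, h3, h4⟩ := hin
  unfold lvl
  by_cases hg : good p t q = true
  · simp only [hg, if_true]
    simp only [good, Bool.and_eq_true, decide_eq_true_eq] at hg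
    omega
  · simp only [hg, Bool.false_eq_true, if_false]
    exact ⟨(tauB_le_left _ _ _ _).trans h1, (tauB_le_right _ _ _ _).trans h3⟩

/-- ONE PAIR of the identity test, as a linear fact: `t(u+v) + pT + lvl·(p − W) ≤ floor(lvl) + rT + bT`. [original] -/
theorem pair_bound {p t W : ℕ} {q : Pr} {u v : ℕ} (hin : PrIn q u v) (hW : W ≤ p) :
    t * (u + v) + pT p W (good p t q) q + lvl p t W q * (p - W) ≤
      FP2.pairFloor p u v (lvl p t W q) + rT p t W (good p t q) + bT t (good p t q) q := by
  obtain ⟨h1, h2, h3, h4⟩ := hin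
  unfold pT lvl rT bT
  by_cases hg : good p t q = true
  · simp only [hg, if_true]
    have hg' := hg
    simp only [good, Bool.and_eq_true, decide_eq_true_eq] at hg'
    have := pairFloor_good (p := p) (u := u) (v := v) (t := t) (by omega) (by omega)
    omega
  · simp only [hg, Bool.false_eq_true, if_false]
    have hb := pairFloor_bad (p := p) (W := W) h1 h3 hW
    have hm : t * (u + v) ≤ t * (q.uh + q.vh) := Nat.mul_le_mul_left _ (by omega)
    omega

/-- **Soundness of the identity test.**  If the four pair boxes contain the true pairs, `W ≤ p`, `S ≤ Σ_g (u_g + v_g)` and (F1) holds, then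
`violT p cap S t W q0 q1 q2 q3 = false`. [original] -/
theorem violT_false {p cap S t W : ℕ} {q0 q1 q2 q3 : Pr} {u0 v0 u1 v1 u2 v2 u3 v3 : ℕ}
    (h0 : PrIn q0 u0 v0) (h1 : PrIn q1 u1 v1) (h2 : PrIn q2 u2 v2) (h3 : PrIn q3 u3 v3) (hW : W ≤ p)
    (hS : S ≤ u0 + v0 + (u1 + v1) + (u2 + v2) + (u3 + v3)) (hF : F1 p cap W u0 v0 u1 v1 u2 v2 u3 v3) :
    violT p cap S t W q0 q1 q2 q3 = false := by
  have c0 := pair_bound (t := t) h0 hW; have l0 := lvl_le (p := p) (t := t) (W := W) h0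
  have c1 := pair_bound (t := t) h1 hW; have l1 := lvl_le (p := p) (t := t) (W := W) h1
  have c2 := pair_bound (t := t) h2 hW; have l2 := lvl_le (p := p) (t := t) (W := W) h2
  have c3 := pair_bound (t := t) h3 hW; have l3 := lvl_le (p := p) (t := t) (W := W) h3
  have hmain := hF _ _ _ _ l0.1 l0.2 l1.1 l1.2 l2.1 l2.2 l3.1 l3.2
  have hmin : W * min (lvl p t W q0 + lvl p t W q1 + lvl p t W q2 + lvl p t W q3) cap ≤ cap * W := by
    rw [Nat.mul_comm cap W]; exact Nat.mul_le_mul_left _ (min_le_right _ _)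
  have hdist : (lvl p t W q0 + lvl p t W q1 + lvl p t W q2 + lvl p t W q3) * (p - W) =
      lvl p t W q0 * (p - W) + lvl p t W q1 * (p - W) + lvl p t W q2 * (p - W) + lvl p t W q3 * (p - W) := by
    simp only [Nat.add_mul]
  have hS' : t * S ≤ t * (u0 + v0) + t * (u1 + v1) + t * (u2 + v2) + t * (u3 + v3) := by
    calc t * S ≤ t * (u0 + v0 + (u1 + v1) + (u2 + v2) + (u3 + v3)) := Nat.mul_le_mul_left _ hS
      _ = _ := by simp only [Nat.mul_add]
  unfold violT
  rw [seqB_eq, seqB_eq, seqB_eq, seqB_eq]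
  simp only [decide_eq_false_iff_not, not_lt]
  omega

/-- **Soundness of the all-pairs test**: under the same hypotheses `viol0 p cap W q0 q1 q2 q3 = false`. [original] -/
theorem viol0_false {p cap W : ℕ} {q0 q1 q2 q3 : Pr} {u0 v0 u1 v1 u2 v2 u3 v3 : ℕ}
    (h0 : PrIn q0 u0 v0) (h1 : PrIn q1 u1 v1) (h2 : PrIn q2 u2 v2) (h3 : PrIn q3 u3 v3) (hW : W ≤ p)
    (hF : F1 p cap W u0 v0 u1 v1 u2 v2 u3 v3) :
    viol0 p cap W q0 q1 q2 q3 = false := by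
  obtain ⟨a0, -, b0, -⟩ := h0; obtain ⟨a1, -, b1, -⟩ := h1; obtain ⟨a2, -, b2, -⟩ := h2; obtain ⟨a3, -, b3, -⟩ := h3
  have c0 := pairFloor_bad (p := p) (W := W) a0 b0 hW
  have c1 := pairFloor_bad (p := p) (W := W) a1 b1 hW
  have c2 := pairFloor_bad (p := p) (W := W) a2 b2 hW
  have c3 := pairFloor_bad (p := p) (W := W) a3 b3 hW
  have hmain := hF _ _ _ _ ((tauB_le_left p W _ _).trans a0) ((tauB_le_right p W _ _).trans b0)
    ((tauB_le_left p W _ _).trans a1) ((tauB_le_right p W _ _).trans b1) ((tauB_le_left p W _ _).trans a2)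
    ((tauB_le_right p W _ _).trans b2) ((tauB_le_left p W _ _).trans a3) ((tauB_le_right p W _ _).trans b3)
  set s0 := tauB p W q0.ul q0.vl; set s1 := tauB p W q1.ul q1.vl; set s2 := tauB p W q2.ul q2.vl; set s3 := tauB p W q3.ul q3.vl
  have hmin : W * min (s0 + s1 + s2 + s3) cap ≤ cap * W := by
    rw [Nat.mul_comm cap W]; exact Nat.mul_le_mul_left _ (min_le_right _ _)
  have hdist : (s0 + s1 + s2 + s3) * (p - W) = s0 * (p - W) + s1 * (p - W) + s2 * (p - W) + s3 * (p - W) := by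
    simp only [Nat.add_mul]
  unfold viol0
  simp only [decide_eq_false_iff_not, not_lt]
  omega

/-- The semantic package of one target: the pair boxes contain the true pairs, `W ≤ p`, the total, and (F1) (semantics of the checker). [original] -/
structure TgtIn (p cap S W : ℕ) (q0 q1 q2 q3 : Pr) (u0 v0 u1 v1 u2 v2 u3 v3 : ℕ) : Prop where
  /-- pair `0` inside its box -/
  in0 : PrIn q0 u0 v0
  /-- pair `1` inside its box -/
  in1 : PrIn q1 u1 v1
  /-- pair `2` inside its box -/
  in2 : PrIn q2 u2 v2
  /-- pair `3` inside its box -/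
  in3 : PrIn q3 u3 v3
  /-- the target count is at most the coset size -/
  hW : W ≤ p
  /-- the identity `S ≤ Σ (u + v)` -/
  hS : S ≤ u0 + v0 + (u1 + v1) + (u2 + v2) + (u3 + v3)
  /-- Pollard per pair, jointly -/
  hF : F1 p cap W u0 v0 u1 v1 u2 v2 u3 v3

/-- `viol` is `false` at the true target count. [original] -/
theorem viol_false {p cap S W : ℕ} (menu : List ℕ) {q0 q1 q2 q3 : Pr} {u0 v0 u1 v1 u2 v2 u3 v3 : ℕ}
    (h : TgtIn p cap S W q0 q1 q2 q3 u0 v0 u1 v1 u2 v2 u3 v3) : viol p cap S menu W q0 q1 q2 q3 = false := by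
  unfold viol
  rw [viol0_false h.in0 h.in1 h.in2 h.in3 h.hW h.hF, Bool.false_or]
  rw [List.any_eq_false]
  intro t _
  rw [violT_false h.in0 h.in1 h.in2 h.in3 h.hW h.hS h.hF]
  exact Bool.false_ne_true

/-- **The scan never undershoots the true target count**: if `W ≤ h` then `W ≤ scanW … h`. [original] -/
theorem le_scanW {p cap S W : ℕ} (menu : List ℕ) {q0 q1 q2 q3 : Pr} {u0 v0 u1 v1 u2 v2 u3 v3 : ℕ}
    (h : TgtIn p cap S W q0 q1 q2 q3 u0 v0 u1 v1 u2 v2 u3 v3) :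
    ∀ hh : ℕ, W ≤ hh → W ≤ scanW p cap S menu q0 q1 q2 q3 hh := by
  intro hh
  induction hh with
  | zero => intro hW0; simpa [scanW] using hW0
  | succ n ih =>
    intro hle
    unfold scanW
    split_ifs with hv
    · refine ih ?_
      rcases Nat.lt_or_eq_of_le hle with hlt | heq
      · omega
      · exfalso
        rw [← heq, viol_false menu h] at hv
        exact Bool.false_ne_true hv
    · exact hle

end CheckCore

end FP4

end Summit.MatrixMultiplication.MatrixMultiplication.Theorems
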